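import Literature.Analysis.FluidPDE.LeiRenZhang2019SwirlPair
import Literature.Analysis.FluidPDE.HessianLaplacian
import HarnessLib

/-!
# Lei–Ren–Zhang 2019, Theorem 1.2: no ancient swirl plateau at a non-zero level

Analysis/FluidPDE support file (all results proved; no definitions, no named facts) on the
discharge path of the named fact `Literature.Analysis.FluidPDE.leiRenZhang2019_liouville_swirl_rate`
(`SelfSimilarLiouville`; Z. Lei, X. Ren, Q. S. Zhang, arXiv:1902.11229, Theorem 1.2 and its
proof, §4 pp. 10–12).

**The analytic core of Theorem 1.2.** In print (§4) the rate hypothesis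
`|Γ² − L²| ≤ ε L²/r` is used to show that a bounded ancient solution cannot have
`lim sup_{r→∞} |Γ| = L ≠ 0`: a weighted energy identity for `Γ` against `λ(r) dr dz`
(`λ = r` near the axis, `λ = 1` far away) produces the main negative term `−RT/6` (the term
`T₂`, p. 11: it comes from the transition of the weight, i.e. from `Γ = 0` on the axis while
`Γ² ≈ 1` at `r = r₀`), every other term being `O(ε ‖v_r‖_∞) RT + o(RT)` (the only term needing
`ε` small is `I₁`, p. 11). Here the same mechanism is run in the linear form of
Koch–Nadirashvili–Seregin–Šverák's proof of their Theorem 5.3 (arXiv:0709.3599, p. 10,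
(5.15)–(5.20)), for which the tree has the complete tool-kit (`SwirlCutoff`,
`CylindricalIntegration`, `KNSSSwirlSupNonpos`, and `LeiRenZhang2019SwirlPair` for bounded
drifts): the swirl equation is tested against `φ = ξ(r) η_N(z) ζ_N(s)`; if `|F − Λ| ≤ δ` on the
annulus `{1 ≤ r ≤ 2}` (all `z`, all times) with `Λ > 0`, the axis term is
`≤ −c₂ (2Λ − 4C_S δ) ∫η ∫ζ ≈ −4c₂ Λ N²`, the transport and Laplacian terms on the annulus are
`≤ 2c₂ δ (C_S C_r + C_Δ) ∫η ∫ζ` (`C_r` a bound for the *radial* drift `⟪V, e_r⟫`, `C_Δ` a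
universal bound for `Δ(ξ∘r)`), and everything else is `O(N)`. Hence
(`LRZPair.false_of_plateau`): **no bounded-drift ancient swirl pair has such a plateau once
`δ (2C_S + C_S C_r + C_Δ) < Λ`.** Because the rate hypothesis of Theorem 1.2 holds on all of
`{r ≥ R₀}`, neither the auxiliary backward parabolic problem `φ₂` of p. 10 nor the preliminary
observation `lim sup |Γ| = sup |Γ|` is needed in this form of the argument.

Contents: the calculus of the cut-off away from the unit cylinder (`Δ(ξ∘r)` is bounded by a
universal constant — by vertical translation invariance and compactness —, the product formulas
for `Dψ_L`, `Δψ_L` with `L`-independent bounds), the three estimates, and the contradiction.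

## References

* Z. Lei, X. Ren, Q. S. Zhang, arXiv:1902.11229, Theorem 1.2, §4 (pp. 10–12). [LeiRenZhang2019]
* G. Koch, N. Nadirashvili, G. Seregin, V. Šverák, Acta Math. 203 (2009) = arXiv:0709.3599,
  proof of Theorem 5.3, (5.15)–(5.20), p. 10. [KochNadirashviliSereginSverak2009]
-/

noncomputable section

open MeasureTheory Set Function Filter Topology TopologicalSpace InnerProductSpace WithLp Metric
open scoped Laplacian RealInnerProductSpace ContDiff

namespace Literature.Analysis.FluidPDE

namespace LRZPair

variable {Cf Cu Cr τ : ℝ} {F : ℝ → (EuclideanSpace ℝ (Fin 3)) → ℝ}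
  {V : ℝ → (EuclideanSpace ℝ (Fin 3)) → (EuclideanSpace ℝ (Fin 3))}

/-! ### The radial cut-off `ξ ∘ r` on all of `ℝ³` -/

section RadialCutoff

/-- The Laplacian commutes with translations. [folklore] -/
theorem laplacian_comp_add_right {E : Type*} [NormedAddCommGroup E] [InnerProductSpace ℝ E]
    [FiniteDimensional ℝ E] (f : E → ℝ) (a x : E) :
    (Δ fun z => f (z + a)) x = (Δ f) (x + a) := by
  rw [laplacian_eq_iteratedFDeriv_stdOrthonormalBasis, laplacian_eq_iteratedFDeriv_stdOrthonormalBasis]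
  simp only [iteratedFDeriv_comp_add_right]

/-- `ξ ∘ r` is invariant under vertical translations. [folklore] -/
theorem xiCut_cylRadius_add_smul_eZ (c : ℝ) (y : EuclideanSpace ℝ (Fin 3)) :
    xiCut (cylRadius (y + c • eZ)) = xiCut (cylRadius y) := by
  rw [add_comm, SereginSverak2009.cylRadius_smul_eZ_add]

/-- The Laplacian of `ξ ∘ r` is invariant under vertical translations. [folklore] -/
theorem laplacian_xiCut_cylRadius_add_smul_eZ (c : ℝ) (y : EuclideanSpace ℝ (Fin 3)) :
    (Δ fun w : EuclideanSpace ℝ (Fin 3) => xiCut (cylRadius w)) (y + c • eZ) =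
      (Δ fun w : EuclideanSpace ℝ (Fin 3) => xiCut (cylRadius w)) y := by
  rw [← laplacian_comp_add_right (fun w : EuclideanSpace ℝ (Fin 3) => xiCut (cylRadius w)) (c • eZ) y]
  simp only [xiCut_cylRadius_add_smul_eZ]

/-- `‖y − y₂ e_z‖ = r(y)`: the horizontal part of `y` has norm the cylindrical radius. [folklore] -/
theorem norm_sub_smul_eZ (y : EuclideanSpace ℝ (Fin 3)) : ‖y - y 2 • eZ‖ = cylRadius y := by
  have h : ‖y - y 2 • eZ‖ ^ 2 = cylRadius y ^ 2 := by
    rw [EuclideanSpace.real_norm_sq_eq, Fin.sum_univ_three, cylRadius_sq]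
    simp [eZ]
  have h1 : 0 ≤ ‖y - y 2 • eZ‖ := norm_nonneg _
  have h2 := cylRadius_nonneg y
  nlinarith [h, h1, h2]

/-- On the open unit cylinder `ξ ∘ r` is locally the constant `1`. [folklore] -/
theorem xiCut_cylRadius_eventuallyEq_one {y : EuclideanSpace ℝ (Fin 3)} (hy : cylRadius y < 1) :
    (fun w : EuclideanSpace ℝ (Fin 3) => xiCut (cylRadius w)) =ᶠ[𝓝 y] fun _ => (1 : ℝ) := by
  filter_upwards [(isOpen_lt continuous_cylRadius continuous_const).mem_nhds hy] with w hw
  exact xiCut_of_le_one (le_of_lt hw)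

/-- The Laplacian of a constant vanishes. [folklore] -/
theorem laplacian_const_eq_zero (m : ℝ) (y : EuclideanSpace ℝ (Fin 3)) :
    (Δ fun _ : EuclideanSpace ℝ (Fin 3) => m) y = 0 := by
  rw [laplacian_eq_iteratedFDeriv_stdOrthonormalBasis]
  simp [iteratedFDeriv_const_of_ne (𝕜 := ℝ) (E := EuclideanSpace ℝ (Fin 3)) two_ne_zero m]

/-- `Δ(ξ∘r) = 0` on the open unit cylinder. [folklore] -/
theorem laplacian_xiCut_cylRadius_of_lt_one {y : EuclideanSpace ℝ (Fin 3)} (hy : cylRadius y < 1) :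
    (Δ fun w : EuclideanSpace ℝ (Fin 3) => xiCut (cylRadius w)) y = 0 :=
  ((laplacian_congr_nhds (xiCut_cylRadius_eventuallyEq_one hy)).eq_of_nhds).trans
    (laplacian_const_eq_zero 1 y)

/-- `D(ξ∘r) = 0` on the open unit cylinder. [folklore] -/
theorem fderiv_xiCut_cylRadius_of_lt_one {y : EuclideanSpace ℝ (Fin 3)} (hy : cylRadius y < 1) :
    fderiv ℝ (fun w : EuclideanSpace ℝ (Fin 3) => xiCut (cylRadius w)) y = 0 := by
  rw [(xiCut_cylRadius_eventuallyEq_one hy).fderiv_eq, fderiv_fun_const, Pi.zero_apply]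

/-- Outside the closed cylinder `{r ≤ 2}` a point is not in the topological support of
`ξ ∘ r`. [folklore] -/
theorem notMem_tsupport_xiCut_cylRadius {y : EuclideanSpace ℝ (Fin 3)} (hy : 2 < cylRadius y) :
    y ∉ tsupport fun w : EuclideanSpace ℝ (Fin 3) => xiCut (cylRadius w) := by
  have hsub : tsupport (fun w : EuclideanSpace ℝ (Fin 3) => xiCut (cylRadius w)) ⊆
      {w | cylRadius w ≤ 2} := by
    refine closure_minimal (fun w hw => ?_) (isClosed_le continuous_cylRadius continuous_const)
    by_contra h
    exact hw (xiCut_of_two_le (le_of_lt (lt_of_not_ge h)))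
  exact fun h => not_le.2 hy (hsub h)

/-- `Δ(ξ∘r) = 0` outside `{r ≤ 2}`. [folklore] -/
theorem laplacian_xiCut_cylRadius_of_two_lt {y : EuclideanSpace ℝ (Fin 3)} (hy : 2 < cylRadius y) :
    (Δ fun w : EuclideanSpace ℝ (Fin 3) => xiCut (cylRadius w)) y = 0 :=
  laplacian_eq_zero_of_notMem_tsupport (notMem_tsupport_xiCut_cylRadius hy)

/-- `D(ξ∘r) = 0` outside `{r ≤ 2}`. [folklore] -/
theorem fderiv_xiCut_cylRadius_of_two_lt {y : EuclideanSpace ℝ (Fin 3)} (hy : 2 < cylRadius y) :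
    fderiv ℝ (fun w : EuclideanSpace ℝ (Fin 3) => xiCut (cylRadius w)) y = 0 :=
  fderiv_of_notMem_tsupport ℝ (notMem_tsupport_xiCut_cylRadius hy)

/-- **A universal bound for `Δ(ξ∘r)`.** The Laplacian of the radial cut-off is bounded on
`ℝ³`: it is continuous, invariant under vertical translations, and vanishes outside `{r ≤ 2}`,
so its supremum is attained on the compact ball `‖y‖ ≤ 2`. [folklore] -/
theorem exists_bound_laplacian_xiCut_cylRadius :
    ∃ C : ℝ, 0 ≤ C ∧ ∀ y : EuclideanSpace ℝ (Fin 3),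
      |(Δ fun w : EuclideanSpace ℝ (Fin 3) => xiCut (cylRadius w)) y| ≤ C := by
  have hA : ContDiff ℝ 2 fun w : EuclideanSpace ℝ (Fin 3) => xiCut (cylRadius w) :=
    contDiff_xiCut_comp_cylRadius
  have hc : Continuous (Δ fun w : EuclideanSpace ℝ (Fin 3) => xiCut (cylRadius w)) :=
    continuous_laplacian hA
  obtain ⟨K, hK⟩ := (isCompact_closedBall (0 : EuclideanSpace ℝ (Fin 3)) 2).exists_bound_of_continuousOn
    hc.continuousOn
  refine ⟨max K 0, le_max_right _ _, fun y => ?_⟩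
  by_cases hy : cylRadius y ≤ 2
  · have hmem : y - y 2 • eZ ∈ closedBall (0 : EuclideanSpace ℝ (Fin 3)) 2 := by
      rw [mem_closedBall, dist_zero_right, norm_sub_smul_eZ]; exact hy
    have h := hK _ hmem
    rw [Real.norm_eq_abs] at h
    have e : (Δ fun w : EuclideanSpace ℝ (Fin 3) => xiCut (cylRadius w)) y =
        (Δ fun w : EuclideanSpace ℝ (Fin 3) => xiCut (cylRadius w)) (y - y 2 • eZ) := by
      rw [← laplacian_xiCut_cylRadius_add_smul_eZ (-(y 2)) y, neg_smul, sub_eq_add_neg]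
    rw [e]
    exact h.trans (le_max_left _ _)
  · rw [laplacian_xiCut_cylRadius_of_two_lt (lt_of_not_ge hy), abs_zero]
    exact le_max_right _ _

/-- **The gradient of `ξ ∘ r` off the axis**: `D(ξ∘r)(y) = ξ'(r) ⟪e_r, ·⟫`. [folklore] -/
theorem hasFDerivAt_xiCut_cylRadius {y : EuclideanSpace ℝ (Fin 3)} (hy : cylRadius y ≠ 0) :
    HasFDerivAt (fun w : EuclideanSpace ℝ (Fin 3) => xiCut (cylRadius w))
      (deriv xiCut (cylRadius y) • innerSL ℝ (eR y)) y :=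
  ((contDiff_xiCut (n := 1)).differentiable one_ne_zero (cylRadius y)).hasDerivAt.comp_hasFDerivAt
    y (hasFDerivAt_cylRadius hy)

/-- `D(ξ∘r)(y)[v] = ξ'(r(y)) ⟪e_r(y), v⟫` off the axis. [folklore] -/
theorem fderiv_xiCut_cylRadius_apply {y : EuclideanSpace ℝ (Fin 3)} (hy : cylRadius y ≠ 0)
    (v : EuclideanSpace ℝ (Fin 3)) :
    fderiv ℝ (fun w : EuclideanSpace ℝ (Fin 3) => xiCut (cylRadius w)) y v =
      deriv xiCut (cylRadius y) * ⟪eR y, v⟫ := by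
  rw [(hasFDerivAt_xiCut_cylRadius hy).fderiv]
  simp only [_root_.smul_apply, innerSL_apply_apply, smul_eq_mul]

/-- **`‖D(ξ∘r)‖ ≤ C_S` everywhere** (`|ξ'| ≤ C_S`, `‖e_r‖ ≤ 1`; on the axis the cut-off is
locally constant). [folklore] -/
theorem norm_fderiv_xiCut_cylRadius_le (y : EuclideanSpace ℝ (Fin 3)) :
    ‖fderiv ℝ (fun w : EuclideanSpace ℝ (Fin 3) => xiCut (cylRadius w)) y‖ ≤ smoothTransitionC2Bound := by
  have hC := smoothTransitionC2Bound_nonneg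
  by_cases hy : cylRadius y = 0
  · rw [fderiv_xiCut_cylRadius_of_lt_one (by rw [hy]; exact one_pos), norm_zero]
    exact hC
  · rw [(hasFDerivAt_xiCut_cylRadius hy).fderiv, norm_smul, Real.norm_eq_abs, innerSL_apply_norm]
    calc |deriv xiCut (cylRadius y)| * ‖eR y‖ ≤ smoothTransitionC2Bound * 1 := by
          gcongr
          · exact abs_deriv_xiCut_le _
          · exact norm_eR_le_one y
      _ = smoothTransitionC2Bound := mul_one _

/-- `|D(ξ∘r)(y)[v]| ≤ C_S ‖v‖`. [folklore] -/
theorem abs_fderiv_xiCut_cylRadius_apply_le (y v : EuclideanSpace ℝ (Fin 3)) :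
    |fderiv ℝ (fun w : EuclideanSpace ℝ (Fin 3) => xiCut (cylRadius w)) y v| ≤
      smoothTransitionC2Bound * ‖v‖ := by
  rw [← Real.norm_eq_abs]
  exact ((fderiv ℝ (fun w : EuclideanSpace ℝ (Fin 3) => xiCut (cylRadius w)) y).le_opNorm v).trans
    (mul_le_mul_of_nonneg_right (norm_fderiv_xiCut_cylRadius_le y) (norm_nonneg _))

end RadialCutoff

/-! ### The spatial cut-off `ψ_L = (ξ∘r) · η_L(y₂)`: gradient and Laplacian with `L`-uniform bounds -/

section SpatialCutoff

/-- The derivative of `y ↦ η_L(y₂)` applied to a vector. [folklore] -/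
theorem fderiv_etaCut_comp_apply_two_apply (L : ℝ) (y v : EuclideanSpace ℝ (Fin 3)) :
    fderiv ℝ (fun w : EuclideanSpace ℝ (Fin 3) => Calculus.cutoff L (w 2)) y v =
      deriv (Calculus.cutoff L) (y 2) * v 2 := by
  rw [(hasFDerivAt_etaCut_comp_apply_two L y).fderiv]
  simp only [_root_.smul_apply, smul_eq_mul, PiLp.proj_apply]

/-- **The gradient of the spatial cut-off** (product rule): for every `y` and `v`,
`Dψ_L(y)[v] = D(ξ∘r)(y)[v] η_L(y₂) + ξ(r) η_L'(y₂) v₂`. [folklore] -/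
theorem fderiv_psiCut_apply (L : ℝ) (y v : EuclideanSpace ℝ (Fin 3)) :
    fderiv ℝ (psiCut L) y v =
      fderiv ℝ (fun w : EuclideanSpace ℝ (Fin 3) => xiCut (cylRadius w)) y v * Calculus.cutoff L (y 2) +
        xiCut (cylRadius y) * (deriv (Calculus.cutoff L) (y 2) * v 2) := by
  have hA : DifferentiableAt ℝ (fun w : EuclideanSpace ℝ (Fin 3) => xiCut (cylRadius w)) y :=
    (contDiff_xiCut_comp_cylRadius (n := 1)).differentiable one_ne_zero y
  have hE : DifferentiableAt ℝ (fun w : EuclideanSpace ℝ (Fin 3) => Calculus.cutoff L (w 2)) y :=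
    (hasFDerivAt_etaCut_comp_apply_two L y).differentiableAt
  have hfun : psiCut L = fun w => (fun w : EuclideanSpace ℝ (Fin 3) => xiCut (cylRadius w)) w *
      (fun w : EuclideanSpace ℝ (Fin 3) => Calculus.cutoff L (w 2)) w := rfl
  rw [hfun, fderiv_fun_mul hA hE]
  simp only [_root_.add_apply, _root_.smul_apply, smul_eq_mul,
    fderiv_etaCut_comp_apply_two_apply]
  ring

/-- **The gradient of the spatial cut-off off the axis**:
`Dψ_L(y)[v] = ξ'(r) ⟪e_r, v⟫ η_L(y₂) + ξ(r) η_L'(y₂) v₂`. [folklore] -/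
theorem fderiv_psiCut_apply_of_ne {L : ℝ} {y : EuclideanSpace ℝ (Fin 3)} (hy : cylRadius y ≠ 0)
    (v : EuclideanSpace ℝ (Fin 3)) :
    fderiv ℝ (psiCut L) y v =
      deriv xiCut (cylRadius y) * ⟪eR y, v⟫ * Calculus.cutoff L (y 2) +
        xiCut (cylRadius y) * (deriv (Calculus.cutoff L) (y 2) * v 2) := by
  rw [fderiv_psiCut_apply, fderiv_xiCut_cylRadius_apply hy]

/-- **The Laplacian of the spatial cut-off** (Leibniz rule, `HessianLaplacian.laplacian_mul_eq`):
`Δψ_L = ξ(r) η_L''(y₂) + η_L(y₂) Δ(ξ∘r) + 2 Σᵢ ∂ᵢ(ξ∘r) ∂ᵢ(η_L∘π₂)`. [folklore] -/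
theorem laplacian_psiCut_eq (L : ℝ) (y : EuclideanSpace ℝ (Fin 3)) :
    (Δ (psiCut L)) y =
      xiCut (cylRadius y) * deriv (deriv (Calculus.cutoff L)) (y 2) +
        Calculus.cutoff L (y 2) * (Δ fun w : EuclideanSpace ℝ (Fin 3) => xiCut (cylRadius w)) y +
        2 * ∑ i : Fin 3, fderiv ℝ (fun w : EuclideanSpace ℝ (Fin 3) => xiCut (cylRadius w)) y
            (EuclideanSpace.basisFun (Fin 3) ℝ i) *
          (deriv (Calculus.cutoff L) (y 2) * (EuclideanSpace.basisFun (Fin 3) ℝ i) 2) := by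
  have hA : ContDiff ℝ 2 fun w : EuclideanSpace ℝ (Fin 3) => xiCut (cylRadius w) := contDiff_xiCut_comp_cylRadius
  have hE : ContDiff ℝ 2 fun w : EuclideanSpace ℝ (Fin 3) => Calculus.cutoff L (w 2) :=
    contDiff_etaCut_comp_apply_two L
  have hfun : psiCut L = fun w => (fun w : EuclideanSpace ℝ (Fin 3) => xiCut (cylRadius w)) w *
      (fun w : EuclideanSpace ℝ (Fin 3) => Calculus.cutoff L (w 2)) w := rfl
  rw [hfun, laplacian_mul_eq (EuclideanSpace.basisFun (Fin 3) ℝ) hA hE y, laplacian_etaCut_comp_apply_two]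
  simp only [fderiv_etaCut_comp_apply_two_apply]

/-- **`L`-uniform pointwise bound for the Laplacian of the spatial cut-off**: with `C_Δ` a bound
for `|Δ(ξ∘r)|`,
`|Δψ_L(y)| ≤ |η_L''(y₂)| + C_Δ' (y) + 6 C_S |η_L'(y₂)|`, where `C_Δ'(y) = |Δ(ξ∘r)(y)| η_L(y₂)`.
[folklore] -/
theorem abs_laplacian_psiCut_le (L : ℝ) (y : EuclideanSpace ℝ (Fin 3)) :
    |(Δ (psiCut L)) y| ≤
      |deriv (deriv (Calculus.cutoff L)) (y 2)| +
        Calculus.cutoff L (y 2) * |(Δ fun w : EuclideanSpace ℝ (Fin 3) => xiCut (cylRadius w)) y| +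
        6 * smoothTransitionC2Bound * |deriv (Calculus.cutoff L) (y 2)| := by
  rw [laplacian_psiCut_eq]
  obtain ⟨hξ0, hξ1⟩ := xiCut_mem_Icc (cylRadius y)
  obtain ⟨hη0, hη1⟩ := etaCut_mem_Icc L (y 2)
  have hC := smoothTransitionC2Bound_nonneg
  set b := EuclideanSpace.basisFun (Fin 3) ℝ with hb
  have hbi : ∀ i : Fin 3, ‖b i‖ = 1 := fun i => b.orthonormal.1 i
  have hb2 : ∀ i : Fin 3, |(b i) 2| ≤ 1 := fun i => by
    have := PiLp.norm_apply_le (b i) 2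
    rw [hbi i, Real.norm_eq_abs] at this
    exact this
  have hterm : ∀ i : Fin 3, |fderiv ℝ (fun w : EuclideanSpace ℝ (Fin 3) => xiCut (cylRadius w)) y (b i) *
      (deriv (Calculus.cutoff L) (y 2) * (b i) 2)| ≤
      smoothTransitionC2Bound * |deriv (Calculus.cutoff L) (y 2)| := by
    intro i
    rw [abs_mul, abs_mul]
    have h1 := abs_fderiv_xiCut_cylRadius_apply_le y (b i)
    rw [hbi i, mul_one] at h1
    have h2 : |deriv (Calculus.cutoff L) (y 2)| * |(b i) 2| ≤ |deriv (Calculus.cutoff L) (y 2)| * 1 :=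
      mul_le_mul_of_nonneg_left (hb2 i) (abs_nonneg _)
    rw [mul_one] at h2
    exact mul_le_mul h1 h2 (by positivity) hC
  have hsum : |∑ i : Fin 3, fderiv ℝ (fun w : EuclideanSpace ℝ (Fin 3) => xiCut (cylRadius w)) y (b i) *
      (deriv (Calculus.cutoff L) (y 2) * (b i) 2)| ≤
      3 * (smoothTransitionC2Bound * |deriv (Calculus.cutoff L) (y 2)|) := by
    refine (Finset.abs_sum_le_sum_abs _ _).trans ?_
    calc ∑ i : Fin 3, |fderiv ℝ (fun w : EuclideanSpace ℝ (Fin 3) => xiCut (cylRadius w)) y (b i) *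
          (deriv (Calculus.cutoff L) (y 2) * (b i) 2)|
        ≤ ∑ _i : Fin 3, smoothTransitionC2Bound * |deriv (Calculus.cutoff L) (y 2)| :=
          Finset.sum_le_sum fun i _ => hterm i
      _ = 3 * (smoothTransitionC2Bound * |deriv (Calculus.cutoff L) (y 2)|) := by
          rw [Finset.sum_const, Finset.card_univ, Fintype.card_fin]; simp
  calc _ ≤ |xiCut (cylRadius y) * deriv (deriv (Calculus.cutoff L)) (y 2) +
        Calculus.cutoff L (y 2) * (Δ fun w : EuclideanSpace ℝ (Fin 3) => xiCut (cylRadius w)) y| +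
        |2 * ∑ i : Fin 3, fderiv ℝ (fun w : EuclideanSpace ℝ (Fin 3) => xiCut (cylRadius w)) y (b i) *
          (deriv (Calculus.cutoff L) (y 2) * (b i) 2)| := abs_add_le _ _
    _ ≤ (|xiCut (cylRadius y) * deriv (deriv (Calculus.cutoff L)) (y 2)| +
        |Calculus.cutoff L (y 2) * (Δ fun w : EuclideanSpace ℝ (Fin 3) => xiCut (cylRadius w)) y|) +
        2 * (3 * (smoothTransitionC2Bound * |deriv (Calculus.cutoff L) (y 2)|)) := by
        refine add_le_add (abs_add_le _ _) ?_
        rw [abs_mul, abs_two]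
        exact mul_le_mul_of_nonneg_left hsum zero_le_two
    _ ≤ _ := by
        rw [abs_mul, abs_mul, abs_of_nonneg hξ0, abs_of_nonneg hη0]
        have h1 : xiCut (cylRadius y) * |deriv (deriv (Calculus.cutoff L)) (y 2)| ≤
            1 * |deriv (deriv (Calculus.cutoff L)) (y 2)| :=
          mul_le_mul_of_nonneg_right hξ1 (abs_nonneg _)
        linarith

end SpatialCutoff

/-! ### Cylinder integrals with an axial weight -/

section Integrals

/-- **A cylinder integral with an axial weight**: `∫ 1_{r ≤ a} g(y₂) dy = (∫ g) c₂ a²/2`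
(integrable), for `g` integrable and `a ≥ 0`. [folklore] -/
theorem integral_cylinder_weight {a : ℝ} (ha : 0 ≤ a) {g : ℝ → ℝ} (hg : Integrable g) :
    Integrable (fun x : EuclideanSpace ℝ (Fin 3) =>
      (Iic a).indicator (fun _ => (1 : ℝ)) (cylRadius x) * g (x 2)) ∧
    ∫ x : EuclideanSpace ℝ (Fin 3), (Iic a).indicator (fun _ => (1 : ℝ)) (cylRadius x) * g (x 2) =
      (∫ z, g z) * (radialConst₂ * (a ^ 2 / 2)) := by
  obtain ⟨h1, h2⟩ := integral_Ioi_mul_indicator_one ha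
  obtain ⟨hi, hv⟩ := integrable_and_integral_fun_cylRadius_mul (h := (Iic a).indicator fun _ => (1 : ℝ))
    (g := g) h1 hg
  exact ⟨hi, by rw [hv, h2]⟩

end Integrals

/-! ### The three estimates under a two-sided plateau on the annulus -/

section Estimates

/-- **Pointwise bound for the transport and Laplacian terms** under the plateau `|F − Λ| ≤ δ`
on the annulus `{1 ≤ r ≤ 2}` (all heights), with a bounded drift `‖V‖ ≤ C_u` whose radial
component is bounded by `C_r` and with `C_Δ` a bound for `|Δ(ξ∘r)|`: off the axis,
`|(F − Λ)(Dφ[V] + Δφ)| ≤ ζ(s) [δ (C_S C_r + C_Δ) η_L(y₂) 1_{r ≤ 2}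
  + (C_f + |Λ|) K_b 1_{r ≤ 2} 1_{S_L}(y₂)]`, `K_b = 2C_S C_u + 4C_S(C_S+1) + 12 C_S²`
(the radial derivative of `ψ` and `Δ(ξ∘r)` live on the annulus, where the plateau applies; the
axial derivatives live on the band `S_L`). [cite: KochNadirashviliSereginSverak2009, proof of Thm 5.3, (5.17)–(5.18) (arXiv p. 10)] -/
theorem pointwise_bound_II {s Λ δ CΔ L T : ℝ}
    (hFb : ∀ x, |F s x| ≤ Cf) (hVb : ∀ x, ‖V s x‖ ≤ Cu) (hVr : ∀ x, |⟪V s x, eR x⟫| ≤ Cr)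
    (hδ : 0 ≤ δ) (hpl : ∀ y, 1 ≤ cylRadius y → cylRadius y ≤ 2 → |F s y - Λ| ≤ δ)
    (hCΔ : ∀ y, |(Δ fun w : EuclideanSpace ℝ (Fin 3) => xiCut (cylRadius w)) y| ≤ CΔ)
    {y : EuclideanSpace ℝ (Fin 3)} (hy : cylRadius y ≠ 0) :
    |(F s y - Λ) * (fderiv ℝ (phiCut L T s) y (V s y) + (Δ (phiCut L T s)) y)| ≤
      zetaCut T s * (δ * (smoothTransitionC2Bound * Cr + CΔ) *
          ((Iic (2 : ℝ)).indicator (fun _ => (1 : ℝ)) (cylRadius y) * Calculus.cutoff L (y 2)) +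
        (Cf + |Λ|) * (2 * smoothTransitionC2Bound * Cu +
            4 * smoothTransitionC2Bound * (smoothTransitionC2Bound + 1) +
            12 * smoothTransitionC2Bound ^ 2) *
          ((Iic (2 : ℝ)).indicator (fun _ => (1 : ℝ)) (cylRadius y) *
            (etaBand L).indicator (fun _ => (1 : ℝ)) (y 2))) := by
  have hC := smoothTransitionC2Bound_nonneg
  have hCf : 0 ≤ Cf := (abs_nonneg _).trans (hFb 0)
  have hCu : 0 ≤ Cu := (norm_nonneg _).trans (hVb 0)
  have hCr : 0 ≤ Cr := (abs_nonneg _).trans (hVr 0)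
  have hCΔ0 : 0 ≤ CΔ := (abs_nonneg _).trans (hCΔ 0)
  obtain ⟨hζ0, -⟩ := zetaCut_mem_Icc T s
  obtain ⟨hξ0, hξ1⟩ := xiCut_mem_Icc (cylRadius y)
  obtain ⟨hη0, hη1⟩ := etaCut_mem_Icc L (y 2)
  have hFΛ : |F s y - Λ| ≤ Cf + |Λ| := (abs_sub _ _).trans (add_le_add (hFb y) le_rfl)
  -- the two formulas
  have hD : fderiv ℝ (phiCut L T s) y (V s y) = zetaCut T s *
      (deriv xiCut (cylRadius y) * ⟪eR y, V s y⟫ * Calculus.cutoff L (y 2) +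
        xiCut (cylRadius y) * (deriv (Calculus.cutoff L) (y 2) * V s y 2)) := by
    rw [fderiv_phiCut_eq, _root_.smul_apply, smul_eq_mul, fderiv_psiCut_apply_of_ne hy]
  have hΔ : (Δ (phiCut L T s)) y = zetaCut T s * (Δ (psiCut L)) y := laplacian_phiCut_eq L T s y
  by_cases hr2 : cylRadius y ≤ 2
  swap
  · -- outside `{r ≤ 2}` the cut-off and all its derivatives vanish
    have hr2' : 2 < cylRadius y := lt_of_not_ge hr2
    have hA0 : xiCut (cylRadius y) = 0 := xiCut_of_two_le hr2'.le
    have hD0 : fderiv ℝ (phiCut L T s) y (V s y) + (Δ (phiCut L T s)) y = 0 := by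
      rw [hD, hΔ, laplacian_psiCut_eq, fderiv_xiCut_cylRadius_of_two_lt hr2',
        laplacian_xiCut_cylRadius_of_two_lt hr2', deriv_xiCut_of_two_lt hr2', hA0]
      simp
    rw [hD0, mul_zero, abs_zero, indicator_of_notMem (show cylRadius y ∉ Iic (2 : ℝ) from fun h => hr2 h)]
    simp
  rw [indicator_of_mem (show cylRadius y ∈ Iic (2 : ℝ) from hr2), one_mul, one_mul]
  -- bounds for the pieces
  have hinner : |⟪eR y, V s y⟫| ≤ Cr := by rw [real_inner_comm]; exact hVr y
  have hV2 : |V s y 2| ≤ Cu := by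
    have := PiLp.norm_apply_le (V s y) 2
    rw [Real.norm_eq_abs] at this
    exact this.trans (hVb y)
  -- the annulus part `P` and the band part `Q` of `|Dψ[V] + Δψ|`
  have hkey : |fderiv ℝ (phiCut L T s) y (V s y) + (Δ (phiCut L T s)) y| ≤ zetaCut T s *
      ((|deriv xiCut (cylRadius y)| * Cr * Calculus.cutoff L (y 2) +
          Calculus.cutoff L (y 2) * |(Δ fun w : EuclideanSpace ℝ (Fin 3) => xiCut (cylRadius w)) y|) +
        (|deriv (Calculus.cutoff L) (y 2)| * Cu + |deriv (deriv (Calculus.cutoff L)) (y 2)| +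
          6 * smoothTransitionC2Bound * |deriv (Calculus.cutoff L) (y 2)|)) := by
    rw [hD, hΔ, ← mul_add, abs_mul, abs_of_nonneg hζ0]
    refine mul_le_mul_of_nonneg_left ?_ hζ0
    have h1 : |deriv xiCut (cylRadius y) * ⟪eR y, V s y⟫ * Calculus.cutoff L (y 2)| ≤
        |deriv xiCut (cylRadius y)| * Cr * Calculus.cutoff L (y 2) := by
      rw [abs_mul, abs_mul, abs_of_nonneg hη0]
      exact mul_le_mul_of_nonneg_right (mul_le_mul_of_nonneg_left hinner (abs_nonneg _)) hη0
    have h2 : |xiCut (cylRadius y) * (deriv (Calculus.cutoff L) (y 2) * V s y 2)| ≤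
        |deriv (Calculus.cutoff L) (y 2)| * Cu := by
      rw [abs_mul, abs_mul, abs_of_nonneg hξ0]
      calc xiCut (cylRadius y) * (|deriv (Calculus.cutoff L) (y 2)| * |V s y 2|)
          ≤ 1 * (|deriv (Calculus.cutoff L) (y 2)| * Cu) := by gcongr
        _ = |deriv (Calculus.cutoff L) (y 2)| * Cu := one_mul _
    have h3 := abs_laplacian_psiCut_le L y
    calc _ ≤ |deriv xiCut (cylRadius y) * ⟪eR y, V s y⟫ * Calculus.cutoff L (y 2) +
          xiCut (cylRadius y) * (deriv (Calculus.cutoff L) (y 2) * V s y 2)| + |(Δ (psiCut L)) y| :=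
          abs_add_le _ _
      _ ≤ (|deriv xiCut (cylRadius y) * ⟪eR y, V s y⟫ * Calculus.cutoff L (y 2)| +
          |xiCut (cylRadius y) * (deriv (Calculus.cutoff L) (y 2) * V s y 2)|) + |(Δ (psiCut L)) y| :=
          add_le_add (abs_add_le _ _) le_rfl
      _ ≤ (|deriv xiCut (cylRadius y)| * Cr * Calculus.cutoff L (y 2) + |deriv (Calculus.cutoff L) (y 2)| * Cu) +
          (|deriv (deriv (Calculus.cutoff L)) (y 2)| +
            Calculus.cutoff L (y 2) * |(Δ fun w : EuclideanSpace ℝ (Fin 3) => xiCut (cylRadius w)) y| +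
            6 * smoothTransitionC2Bound * |deriv (Calculus.cutoff L) (y 2)|) :=
          add_le_add (add_le_add h1 h2) h3
      _ = _ := by ring
  -- the plateau controls the annulus part
  have hP : |F s y - Λ| * (|deriv xiCut (cylRadius y)| * Cr * Calculus.cutoff L (y 2) +
      Calculus.cutoff L (y 2) * |(Δ fun w : EuclideanSpace ℝ (Fin 3) => xiCut (cylRadius w)) y|) ≤
      δ * (smoothTransitionC2Bound * Cr + CΔ) * Calculus.cutoff L (y 2) := by
    by_cases hr1 : 1 ≤ cylRadius y
    · have hFδ := hpl y hr1 hr2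
      have a1 : |deriv xiCut (cylRadius y)| * Cr * Calculus.cutoff L (y 2) ≤
          smoothTransitionC2Bound * Cr * Calculus.cutoff L (y 2) :=
        mul_le_mul_of_nonneg_right (mul_le_mul_of_nonneg_right (abs_deriv_xiCut_le _) hCr) hη0
      have a2 : Calculus.cutoff L (y 2) * |(Δ fun w : EuclideanSpace ℝ (Fin 3) => xiCut (cylRadius w)) y| ≤
          Calculus.cutoff L (y 2) * CΔ := mul_le_mul_of_nonneg_left (hCΔ y) hη0
      have hPle : |deriv xiCut (cylRadius y)| * Cr * Calculus.cutoff L (y 2) +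
          Calculus.cutoff L (y 2) * |(Δ fun w : EuclideanSpace ℝ (Fin 3) => xiCut (cylRadius w)) y| ≤
          (smoothTransitionC2Bound * Cr + CΔ) * Calculus.cutoff L (y 2) := by linarith
      have hP0 : 0 ≤ |deriv xiCut (cylRadius y)| * Cr * Calculus.cutoff L (y 2) +
          Calculus.cutoff L (y 2) * |(Δ fun w : EuclideanSpace ℝ (Fin 3) => xiCut (cylRadius w)) y| := by
        positivity
      calc _ ≤ δ * ((smoothTransitionC2Bound * Cr + CΔ) * Calculus.cutoff L (y 2)) :=
            mul_le_mul hFδ hPle hP0 hδ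
        _ = _ := by ring
    · have hr1' : cylRadius y < 1 := lt_of_not_ge hr1
      rw [deriv_xiCut_of_lt_one hr1', laplacian_xiCut_cylRadius_of_lt_one hr1']
      simp only [abs_zero, zero_mul, mul_zero, add_zero]
      positivity
  -- the band controls the axial part
  have hQ : |F s y - Λ| * (|deriv (Calculus.cutoff L) (y 2)| * Cu + |deriv (deriv (Calculus.cutoff L)) (y 2)| +
      6 * smoothTransitionC2Bound * |deriv (Calculus.cutoff L) (y 2)|) ≤
      (Cf + |Λ|) * (2 * smoothTransitionC2Bound * Cu +
        4 * smoothTransitionC2Bound * (smoothTransitionC2Bound + 1) + 12 * smoothTransitionC2Bound ^ 2) *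
        (etaBand L).indicator (fun _ => (1 : ℝ)) (y 2) := by
    by_cases hz : y 2 ∈ etaBand L
    · rw [indicator_of_mem hz, mul_one]
      have b1 := abs_deriv_etaCut_le L (y 2)
      have b2 := abs_deriv_deriv_etaCut_le L (y 2)
      have c1 : |deriv (Calculus.cutoff L) (y 2)| * Cu ≤ 2 * smoothTransitionC2Bound * Cu :=
        mul_le_mul_of_nonneg_right b1 hCu
      have c3 : 6 * smoothTransitionC2Bound * |deriv (Calculus.cutoff L) (y 2)| ≤
          6 * smoothTransitionC2Bound * (2 * smoothTransitionC2Bound) :=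
        mul_le_mul_of_nonneg_left b1 (by positivity)
      have hQle : |deriv (Calculus.cutoff L) (y 2)| * Cu + |deriv (deriv (Calculus.cutoff L)) (y 2)| +
          6 * smoothTransitionC2Bound * |deriv (Calculus.cutoff L) (y 2)| ≤
          2 * smoothTransitionC2Bound * Cu +
            4 * smoothTransitionC2Bound * (smoothTransitionC2Bound + 1) + 12 * smoothTransitionC2Bound ^ 2 := by
        nlinarith [c1, b2, c3]
      have hQ0 : 0 ≤ |deriv (Calculus.cutoff L) (y 2)| * Cu + |deriv (deriv (Calculus.cutoff L)) (y 2)| +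
          6 * smoothTransitionC2Bound * |deriv (Calculus.cutoff L) (y 2)| := by positivity
      exact mul_le_mul hFΛ hQle hQ0 (by positivity)
    · obtain ⟨e1, e2⟩ := derivs_etaCut_eq_zero_of_not_mem_etaBand hz
      rw [e1, e2, indicator_of_notMem hz]
      simp
  -- assemble
  calc |(F s y - Λ) * (fderiv ℝ (phiCut L T s) y (V s y) + (Δ (phiCut L T s)) y)|
      = |F s y - Λ| * |fderiv ℝ (phiCut L T s) y (V s y) + (Δ (phiCut L T s)) y| := abs_mul _ _
    _ ≤ |F s y - Λ| * (zetaCut T s *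
        ((|deriv xiCut (cylRadius y)| * Cr * Calculus.cutoff L (y 2) +
            Calculus.cutoff L (y 2) * |(Δ fun w : EuclideanSpace ℝ (Fin 3) => xiCut (cylRadius w)) y|) +
          (|deriv (Calculus.cutoff L) (y 2)| * Cu + |deriv (deriv (Calculus.cutoff L)) (y 2)| +
            6 * smoothTransitionC2Bound * |deriv (Calculus.cutoff L) (y 2)|))) :=
        mul_le_mul_of_nonneg_left hkey (abs_nonneg _)
    _ = zetaCut T s * (|F s y - Λ| * (|deriv xiCut (cylRadius y)| * Cr * Calculus.cutoff L (y 2) +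
            Calculus.cutoff L (y 2) * |(Δ fun w : EuclideanSpace ℝ (Fin 3) => xiCut (cylRadius w)) y|) +
          |F s y - Λ| * (|deriv (Calculus.cutoff L) (y 2)| * Cu + |deriv (deriv (Calculus.cutoff L)) (y 2)| +
            6 * smoothTransitionC2Bound * |deriv (Calculus.cutoff L) (y 2)|)) := by ring
    _ ≤ _ := by
        refine mul_le_mul_of_nonneg_left ?_ hζ0
        exact add_le_add hP hQ

/-- **Estimate of the transport and Laplacian terms** (integrated form of `pointwise_bound_II`):
`|∫ (F − Λ)(Dφ[V] + Δφ) dy| ≤ ζ(s) [2c₂ δ (C_S C_r + C_Δ) ∫η_L + 4c₂ (C_f + |Λ|) K_b]`, for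
`L ≥ 1`. [cite: KochNadirashviliSereginSverak2009, proof of Thm 5.3, (5.17)–(5.18) (arXiv p. 10)] -/
theorem estimate_II {s Λ δ CΔ L T : ℝ}
    (hFb : ∀ x, |F s x| ≤ Cf) (hVb : ∀ x, ‖V s x‖ ≤ Cu)
    (hVr : ∀ x, |⟪V s x, eR x⟫| ≤ Cr)
    (hδ : 0 ≤ δ) (hpl : ∀ y, 1 ≤ cylRadius y → cylRadius y ≤ 2 → |F s y - Λ| ≤ δ)
    (hCΔ : ∀ y, |(Δ fun w : EuclideanSpace ℝ (Fin 3) => xiCut (cylRadius w)) y| ≤ CΔ)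
    (hL : 1 ≤ L) :
    |∫ y, (F s y - Λ) * (fderiv ℝ (phiCut L T s) y (V s y) + (Δ (phiCut L T s)) y)| ≤
      zetaCut T s * (δ * (smoothTransitionC2Bound * Cr + CΔ) *
          ((∫ z, Calculus.cutoff L z) * (radialConst₂ * 2)) +
        (Cf + |Λ|) * (2 * smoothTransitionC2Bound * Cu +
            4 * smoothTransitionC2Bound * (smoothTransitionC2Bound + 1) +
            12 * smoothTransitionC2Bound ^ 2) * (radialConst₂ * 4)) := by
  have hC := smoothTransitionC2Bound_nonneg
  have hCf : 0 ≤ Cf := (abs_nonneg _).trans (hFb 0)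
  have hCu : 0 ≤ Cu := (norm_nonneg _).trans (hVb 0)
  have hCr : 0 ≤ Cr := (abs_nonneg _).trans (hVr 0)
  have hCΔ0 : 0 ≤ CΔ := (abs_nonneg _).trans (hCΔ 0)
  have hc₂ := radialConst₂_pos
  obtain ⟨hζ0, -⟩ := zetaCut_mem_Icc T s
  obtain ⟨hηi, -⟩ := integrable_cutoff_and_le_integral hL
  obtain ⟨hiW, hW⟩ := integral_cylinder_weight (zero_le_two) hηi
  obtain ⟨hiB, hB⟩ := integral_cylinder_indicator (zero_le_two) (measurableSet_etaBand L) (volume_etaBand_lt_top L)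
  set K₁ : ℝ := δ * (smoothTransitionC2Bound * Cr + CΔ) with hK₁
  set Kb : ℝ := (Cf + |Λ|) * (2 * smoothTransitionC2Bound * Cu +
    4 * smoothTransitionC2Bound * (smoothTransitionC2Bound + 1) + 12 * smoothTransitionC2Bound ^ 2) with hKb
  have hK₁0 : 0 ≤ K₁ := by positivity
  have hKb0 : 0 ≤ Kb := by positivity
  set bnd : EuclideanSpace ℝ (Fin 3) → ℝ := fun y => zetaCut T s *
    (K₁ * ((Iic (2 : ℝ)).indicator (fun _ => (1 : ℝ)) (cylRadius y) * Calculus.cutoff L (y 2)) +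
      Kb * ((Iic (2 : ℝ)).indicator (fun _ => (1 : ℝ)) (cylRadius y) *
        (etaBand L).indicator (fun _ => (1 : ℝ)) (y 2))) with hbnd
  have hbint : Integrable bnd := ((hiW.const_mul K₁).add (hiB.const_mul Kb)).const_mul _
  have hle : ∀ᵐ y ∂(volume : Measure (EuclideanSpace ℝ (Fin 3))),
      ‖(F s y - Λ) * (fderiv ℝ (phiCut L T s) y (V s y) + (Δ (phiCut L T s)) y)‖ ≤ bnd y := by
    filter_upwards [ae_cylRadius_ne_zero] with y hy
    rw [Real.norm_eq_abs]
    have h := pointwise_bound_II (F := F) (V := V) (L := L) (T := T) hFb hVb hVr hδ hpl hCΔ hy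
    simpa only [hbnd, hK₁, hKb] using h
  have h := norm_integral_le_of_norm_le hbint hle
  rw [Real.norm_eq_abs] at h
  refine h.trans ?_
  simp only [hbnd]
  rw [integral_const_mul, integral_add (hiW.const_mul K₁) (hiB.const_mul Kb), integral_const_mul,
    integral_const_mul, hW, hB]
  have hvb := volume_real_etaBand_le L
  have hvb0 : 0 ≤ volume.real (etaBand L) := measureReal_nonneg
  refine mul_le_mul_of_nonneg_left ?_ hζ0
  have e1 : K₁ * ((∫ z, Calculus.cutoff L z) * (radialConst₂ * ((2 : ℝ) ^ 2 / 2))) =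
      K₁ * ((∫ z, Calculus.cutoff L z) * (radialConst₂ * 2)) := by norm_num
  have e2 : Kb * (volume.real (etaBand L) * (radialConst₂ * ((2 : ℝ) ^ 2 / 2))) ≤ Kb * (radialConst₂ * 4) := by
    refine mul_le_mul_of_nonneg_left ?_ hKb0
    nlinarith
  linarith [e1, e2]

/-- **Estimate of the time-derivative term** (KNSS 2009, (5.18), the term `I`): on a slice,
`|∫ (F − Λ) ψ_L ζ'(s) dy| ≤ |ζ'(s)| L c₂ ((C_f + |Λ|) + 4δ)` — the unit cylinder contributes
through `|F − Λ| ≤ C_f + |Λ|`, the annulus through the plateau. [cite: KochNadirashviliSereginSverak2009, proof of Thm 5.3, (5.18) (arXiv p. 10)] -/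
theorem estimate_I {s Λ δ L T : ℝ} (hFb : ∀ x, |F s x| ≤ Cf)
    (hδ : 0 ≤ δ) (hpl : ∀ y, 1 ≤ cylRadius y → cylRadius y ≤ 2 → |F s y - Λ| ≤ δ) (hL : 0 ≤ L) :
    |∫ y, (F s y - Λ) * (psiCut L y * deriv (zetaCut T) s)| ≤
      |deriv (zetaCut T) s| * (L * radialConst₂ * ((Cf + |Λ|) + 4 * δ)) := by
  have hCf : 0 ≤ Cf := (abs_nonneg _).trans (hFb 0)
  have hM : 0 ≤ Cf + |Λ| := by positivity
  have hz0 : 0 ≤ |deriv (zetaCut T) s| := abs_nonneg _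
  have hS : MeasurableSet (Icc (-L) L) := measurableSet_Icc
  have hSfin : volume (Icc (-L) L) < ⊤ := measure_Icc_lt_top
  have hSvol : volume.real (Icc (-L) L) = 2 * L := by rw [Real.volume_real_Icc_of_le (by linarith)]; ring
  obtain ⟨hi1, hv1⟩ := integral_cylinder_indicator zero_le_one hS hSfin
  obtain ⟨hi2, hv2⟩ := integral_cylinder_indicator zero_le_two hS hSfin
  set bound : EuclideanSpace ℝ (Fin 3) → ℝ := fun y => |deriv (zetaCut T) s| *
    ((Cf + |Λ|) * ((Iic (1 : ℝ)).indicator (fun _ => (1 : ℝ)) (cylRadius y) *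
        (Icc (-L) L).indicator (fun _ => (1 : ℝ)) (y 2)) +
      δ * ((Iic (2 : ℝ)).indicator (fun _ => (1 : ℝ)) (cylRadius y) *
        (Icc (-L) L).indicator (fun _ => (1 : ℝ)) (y 2))) with hbound
  have hbint : Integrable bound := ((hi1.const_mul _).add (hi2.const_mul _)).const_mul _
  have hind : ∀ (A : Set ℝ) (t : ℝ), 0 ≤ A.indicator (fun _ => (1 : ℝ)) t := fun A t =>
    indicator_nonneg (fun _ _ => zero_le_one) _
  have hle : ∀ y, ‖(F s y - Λ) * (psiCut L y * deriv (zetaCut T) s)‖ ≤ bound y := by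
    intro y
    rw [Real.norm_eq_abs]
    have hb0 : 0 ≤ bound y := by
      simp only [hbound]
      exact mul_nonneg hz0 (add_nonneg (mul_nonneg hM (mul_nonneg (hind _ _) (hind _ _)))
        (mul_nonneg hδ (mul_nonneg (hind _ _) (hind _ _))))
    by_cases hψ : psiCut L y = 0
    · rw [hψ, zero_mul, mul_zero, abs_zero]; exact hb0
    obtain ⟨hr2, hzL⟩ := mem_of_psiCut_ne_zero hψ
    have hz : y 2 ∈ Icc (-L) L := ⟨by linarith [(abs_lt.1 hzL).1], (abs_lt.1 hzL).2.le⟩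
    have hr2' : cylRadius y ∈ Iic (2 : ℝ) := hr2.le
    obtain ⟨ψ0, ψ1⟩ := psiCut_mem_Icc L y
    rw [abs_mul, abs_mul, abs_of_nonneg ψ0]
    have hψz : psiCut L y * |deriv (zetaCut T) s| ≤ |deriv (zetaCut T) s| := by nlinarith
    by_cases hr1 : cylRadius y ≤ 1
    · have hr1' : cylRadius y ∈ Iic (1 : ℝ) := hr1
      have h1 : |F s y - Λ| ≤ Cf + |Λ| := (abs_sub _ _).trans (add_le_add (hFb y) le_rfl)
      simp only [hbound, indicator_of_mem hr1', indicator_of_mem hr2', indicator_of_mem hz, mul_one]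
      have : |F s y - Λ| * (psiCut L y * |deriv (zetaCut T) s|) ≤ (Cf + |Λ|) * |deriv (zetaCut T) s| :=
        mul_le_mul h1 hψz (by positivity) hM
      nlinarith
    · have h1 : |F s y - Λ| ≤ δ := hpl y (lt_of_not_ge hr1).le hr2.le
      simp only [hbound, indicator_of_mem hr2', indicator_of_mem hz, mul_one]
      have : |F s y - Λ| * (psiCut L y * |deriv (zetaCut T) s|) ≤ δ * |deriv (zetaCut T) s| :=
        mul_le_mul h1 hψz (by positivity) hδ
      nlinarith [mul_nonneg hz0 (mul_nonneg hM (hind (Iic (1 : ℝ)) (cylRadius y)))]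
  have h := norm_integral_le_of_norm_le hbint (Eventually.of_forall hle)
  rw [Real.norm_eq_abs] at h
  refine h.trans (le_of_eq ?_)
  simp only [hbound]
  rw [integral_const_mul, integral_add (hi1.const_mul _) (hi2.const_mul _), integral_const_mul,
    integral_const_mul, hv1, hv2, hSvol]
  ring

/-- **Estimate of the axis term** (KNSS 2009, p. 10, (5.19)–(5.20): "the key point then is
that `f` vanishes at the `x₃`-axis"): on a slice,
`∫ (2/r) F ∂ᵣφ dy ≤ −ζ(s) c₂ (2Λ − 4 C_S δ) ∫η_L`, because `∂ᵣφ = ξ'(r) η ζ` lives on the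
annulus where `F = Λ + O(δ)`, and `∫ (2/r) ξ'(r) η dy = −2c₂ ∫η`. [cite: KochNadirashviliSereginSverak2009, proof of Thm 5.3, (5.19)–(5.20) (arXiv p. 10)] -/
theorem estimate_III {s Λ δ L T : ℝ} (hFs : ContDiff ℝ ∞ (F s))
    (hδ : 0 ≤ δ) (hpl : ∀ y, 1 ≤ cylRadius y → cylRadius y ≤ 2 → |F s y - Λ| ≤ δ) (hL : 1 ≤ L) :
    ∫ y, 2 / cylRadius y * (F s y * fderiv ℝ (phiCut L T s) y (eR y)) ≤
      -(zetaCut T s * ((∫ z, Calculus.cutoff L z) * (radialConst₂ * (2 * Λ - 4 * smoothTransitionC2Bound * δ)))) := by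
  have hC := smoothTransitionC2Bound_nonneg
  have hc₂ := radialConst₂_pos
  obtain ⟨hζ0, -⟩ := zetaCut_mem_Icc T s
  obtain ⟨hηi, -⟩ := integrable_cutoff_and_le_integral hL
  obtain ⟨hGi, hGval⟩ := integral_two_div_cylRadius_mul_deriv_xiCut hηi
  obtain ⟨hiW, hW⟩ := integral_cylinder_weight (zero_le_two) hηi
  have hF1 : ContDiff ℝ 1 (F s) := hFs.of_le (by norm_cast)
  -- the integrand is `ζ (Λ G₁ + (F − Λ) G₁)` with `G₁ = (2/r) ξ'(r) η`
  set G₁ : EuclideanSpace ℝ (Fin 3) → ℝ := fun y => 2 / cylRadius y * deriv xiCut (cylRadius y) *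
    Calculus.cutoff L (y 2) with hG₁
  have heq : (fun y => 2 / cylRadius y * (F s y * fderiv ℝ (phiCut L T s) y (eR y))) =
      fun y => zetaCut T s * (Λ * G₁ y) + zetaCut T s * ((F s y - Λ) * G₁ y) := by
    funext y
    rw [fderiv_phiCut_apply_eR, hG₁]
    ring
  -- the error term is dominated by `2 δ C_S 1_{r ≤ 2} η`
  have hRle : ∀ y, |(F s y - Λ) * G₁ y| ≤ 2 * δ * smoothTransitionC2Bound *
      ((Iic (2 : ℝ)).indicator (fun _ => (1 : ℝ)) (cylRadius y) * Calculus.cutoff L (y 2)) := by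
    intro y
    obtain ⟨hη0, -⟩ := etaCut_mem_Icc L (y 2)
    by_cases hr1 : 1 ≤ cylRadius y
    · by_cases hr2 : cylRadius y ≤ 2
      · have hFδ := hpl y hr1 hr2
        rw [indicator_of_mem (show cylRadius y ∈ Iic (2 : ℝ) from hr2), one_mul]
        simp only [hG₁]
        have hr0 : 0 < cylRadius y := one_pos.trans_le hr1
        have h2r : |2 / cylRadius y| ≤ 2 := by
          rw [abs_of_nonneg (by positivity), div_le_iff₀ hr0]; linarith
        have hξ := abs_deriv_xiCut_le (cylRadius y)
        simp only [abs_mul, abs_of_nonneg hη0]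
        have h1 : |2 / cylRadius y| * |deriv xiCut (cylRadius y)| ≤ 2 * smoothTransitionC2Bound :=
          mul_le_mul h2r hξ (abs_nonneg _) zero_le_two
        calc |F s y - Λ| * (|2 / cylRadius y| * |deriv xiCut (cylRadius y)| * Calculus.cutoff L (y 2))
            ≤ δ * (2 * smoothTransitionC2Bound * Calculus.cutoff L (y 2)) :=
              mul_le_mul hFδ (mul_le_mul_of_nonneg_right h1 hη0) (by positivity) hδ
          _ = _ := by ring
      · have h0 : G₁ y = 0 := by
          simp only [hG₁, deriv_xiCut_of_two_lt (lt_of_not_ge hr2), mul_zero, zero_mul]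
        rw [h0, mul_zero, abs_zero]
        exact mul_nonneg (by positivity) (mul_nonneg (indicator_nonneg (fun _ _ => zero_le_one) _) hη0)
    · have h0 : G₁ y = 0 := by
        simp only [hG₁, deriv_xiCut_of_lt_one (lt_of_not_ge hr1), mul_zero, zero_mul]
      rw [h0, mul_zero, abs_zero]
      exact mul_nonneg (by positivity) (mul_nonneg (indicator_nonneg (fun _ _ => zero_le_one) _) hη0)
  have hRm : AEStronglyMeasurable (fun y => (F s y - Λ) * G₁ y) volume :=
    ((hF1.continuous.sub continuous_const).aestronglyMeasurable).mul hGi.aestronglyMeasurable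
  have hRi : Integrable fun y => (F s y - Λ) * G₁ y := by
    refine (hiW.const_mul (2 * δ * smoothTransitionC2Bound)).mono' hRm (Eventually.of_forall fun y => ?_)
    rw [Real.norm_eq_abs]
    exact hRle y
  have hRint : ∫ y, (F s y - Λ) * G₁ y ≤ 2 * δ * smoothTransitionC2Bound *
      ((∫ z, Calculus.cutoff L z) * (radialConst₂ * 2)) := by
    have h := norm_integral_le_of_norm_le (hiW.const_mul (2 * δ * smoothTransitionC2Bound))
      (Eventually.of_forall fun y => by rw [Real.norm_eq_abs]; exact hRle y)
    rw [Real.norm_eq_abs, integral_const_mul, hW] at h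
    have h' := (le_abs_self _).trans h
    norm_num at h' ⊢
    linarith
  rw [heq, integral_add ((hGi.const_mul Λ).const_mul _) (hRi.const_mul _), integral_const_mul,
    integral_const_mul, integral_const_mul, hGval]
  have key : zetaCut T s * (∫ y, (F s y - Λ) * G₁ y) ≤
      zetaCut T s * (2 * δ * smoothTransitionC2Bound * ((∫ z, Calculus.cutoff L z) * (radialConst₂ * 2))) :=
    mul_le_mul_of_nonneg_left hRint hζ0
  nlinarith [key]

/-- `∫₀ᵀ ζ ≤ T` for `T ≥ 0` (`0 ≤ ζ ≤ 1`). [folklore] -/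
theorem integral_zetaCut_le {T : ℝ} (hT : 0 ≤ T) : ∫ s in Ioc 0 T, zetaCut T s ≤ T := by
  calc ∫ s in Ioc 0 T, zetaCut T s ≤ ∫ _ in Ioc 0 T, (1 : ℝ) :=
        integral_mono_of_nonneg (Eventually.of_forall fun s => (zetaCut_mem_Icc T s).1)
          (integrableOn_const (C := (1 : ℝ)) measure_Ioc_lt_top.ne) (Eventually.of_forall fun s => (zetaCut_mem_Icc T s).2)
    _ = T := by rw [integral_Ioc_const hT, mul_one]

/-- `∫ η_L ≤ 2L` for `L ≥ 0` (`0 ≤ η_L ≤ 1`, supported in `[−L, L]`). [folklore] -/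
theorem integral_cutoff_le {L : ℝ} (hL : 1 ≤ L) : ∫ z, Calculus.cutoff L z ≤ 2 * L := by
  obtain ⟨hηi, -⟩ := integrable_cutoff_and_le_integral hL
  have hind : Integrable ((Icc (-L) L).indicator fun _ : ℝ => (1 : ℝ)) :=
    (integrableOn_const (C := (1 : ℝ)) (measure_Icc_lt_top (a := -L) (b := L)).ne).integrable_indicator
      measurableSet_Icc
  have hle : ∀ z, Calculus.cutoff L z ≤ (Icc (-L) L).indicator (fun _ : ℝ => (1 : ℝ)) z := by
    intro z
    by_cases hz : z ∈ Icc (-L) L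
    · rw [indicator_of_mem hz]; exact Calculus.cutoff_le_one L z
    · rw [indicator_of_notMem hz, Calculus.cutoff_eq_zero]
      rw [mem_Icc, not_and_or, not_le, not_le] at hz
      rcases hz with hz | hz
      · rw [le_abs]; right; linarith
      · rw [le_abs]; left; linarith
  have h := integral_mono hηi hind hle
  rw [integral_indicator measurableSet_Icc, setIntegral_const, smul_eq_mul, mul_one,
    Real.volume_real_Icc_of_le (by linarith)] at h
  linarith

end Estimates

/-! ### The contradiction -/

section Main

/-- **The main inequality on a window** (KNSS 2009, p. 10, (5.15)–(5.20) integrated, with the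
plateau of Lei–Ren–Zhang's Theorem 1.2 in place of the Lemma 2.1 plateau): for a bounded-drift
pair on `s < τ` with the plateau `|F − Λ| ≤ δ` on `{1 ≤ r ≤ 2}` (all heights, all times), the
space–time identity against `φ_{N,N}` and the three estimates give, when
`m = 2Λ − δ(4C_S + 2(C_S C_r + C_Δ)) ≥ 0` and `3 ≤ N < τ`,
`2(N−1)(N−3) c₂ m ≤ N c₂ [4C_S((C_f+|Λ|) + 4δ) + 4(C_f+|Λ|)K_b]`. [cite: LeiRenZhang2019, proof of Thm 1.2, §4 Steps 3–6 (arXiv pp. 10–12); KochNadirashviliSereginSverak2009, proof of Thm 5.3, (5.15)–(5.20) (arXiv p. 10)] -/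
theorem ineq_of_plateau
    (hF : ∀ t < τ, ContDiff ℝ ∞ (F t))
    (hFd : ContinuousOn (fun p : ℝ × (EuclideanSpace ℝ (Fin 3)) => fderiv ℝ (F p.1) p.2) (Iio τ ×ˢ univ))
    (hFΔ : ContinuousOn (fun p : ℝ × (EuclideanSpace ℝ (Fin 3)) => (Δ (F p.1)) p.2) (Iio τ ×ˢ univ))
    (hFa : ∀ t < τ, IsAxisymmetricScalar (F t))
    (hF0 : ∀ t < τ, ∀ x, cylRadius x = 0 → F t x = 0)
    (hFb : ∀ t < τ, ∀ x, |F t x| ≤ Cf)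
    (hVm : Measurable (uncurry V))
    (hVs : ∀ t < τ, ContDiff ℝ ∞ (V t))
    (hVdiv : ∀ t < τ, VectorCalculus.IsDivFree (V t))
    (hVb : ∀ t < τ, ∀ x, ‖V t x‖ ≤ Cu)
    (hVr : ∀ t < τ, ∀ x, |⟪V t x, eR x⟫| ≤ Cr)
    (heq : ∀ x, cylRadius x ≠ 0 → ∀ s t : ℝ, s ≤ t → t < τ →
      F t x - F s x = ∫ r in s..t, ((Δ (F r)) x - fderiv ℝ (F r) x (V r x) -
        2 / cylRadius x * partialDeriv (eR x) (F r) x))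
    {Λ δ CΔ N : ℝ} (hδ : 0 ≤ δ)
    (hpl : ∀ s < τ, ∀ y, 1 ≤ cylRadius y → cylRadius y ≤ 2 → |F s y - Λ| ≤ δ)
    (hCΔ : ∀ y, |(Δ fun w : EuclideanSpace ℝ (Fin 3) => xiCut (cylRadius w)) y| ≤ CΔ)
    (hm : 0 ≤ 2 * Λ - δ * (4 * smoothTransitionC2Bound + 2 * (smoothTransitionC2Bound * Cr + CΔ)))
    (hN3 : 3 ≤ N) (hNτ : N < τ) :
    2 * (N - 1) * (N - 3) * (radialConst₂ *
        (2 * Λ - δ * (4 * smoothTransitionC2Bound + 2 * (smoothTransitionC2Bound * Cr + CΔ)))) ≤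
      N * (radialConst₂ * (4 * smoothTransitionC2Bound * ((Cf + |Λ|) + 4 * δ) +
        4 * ((Cf + |Λ|) * (2 * smoothTransitionC2Bound * Cu +
            4 * smoothTransitionC2Bound * (smoothTransitionC2Bound + 1) +
            12 * smoothTransitionC2Bound ^ 2)))) := by
  have hC := smoothTransitionC2Bound_nonneg
  have hc₂ := radialConst₂_pos
  have hN0 : (0 : ℝ) ≤ N := by linarith
  have hN1 : (1 : ℝ) ≤ N := by linarith
  have hCf : 0 ≤ Cf := (abs_nonneg _).trans (hFb (τ - 1) (by linarith) 0)
  have hCu : 0 ≤ Cu := (norm_nonneg _).trans (hVb (τ - 1) (by linarith) 0)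
  have hCr : 0 ≤ Cr := (abs_nonneg _).trans (hVr (τ - 1) (by linarith) 0)
  have hCΔ0 : 0 ≤ CΔ := (abs_nonneg _).trans (hCΔ 0)
  have hτ' : ∀ s ∈ Ioc (0 : ℝ) N, s < τ := fun s hs => lt_of_le_of_lt hs.2 hNτ
  -- the identity and the three estimates on the window `(0, N]` with `L = N`
  obtain ⟨hi1, hi2, hi3, hsum⟩ := spaceTime_identity hF hFd hFΔ hFa hF0 hFb hVm hVs hVdiv hVb heq
    (L := N) hN0 hNτ Λ
  obtain ⟨hηi, hηge⟩ := integrable_cutoff_and_le_integral hN1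
  have hηle := integral_cutoff_le hN1
  set Z : ℝ := ∫ z, Calculus.cutoff N z with hZ
  have hZ0 : 0 ≤ Z := by linarith
  set Kb : ℝ := (Cf + |Λ|) * (2 * smoothTransitionC2Bound * Cu +
    4 * smoothTransitionC2Bound * (smoothTransitionC2Bound + 1) + 12 * smoothTransitionC2Bound ^ 2) with hKb
  have hKb0 : 0 ≤ Kb := by positivity
  set K₁ : ℝ := N * radialConst₂ * ((Cf + |Λ|) + 4 * δ) with hK₁
  have hK₁0 : 0 ≤ K₁ := by positivity
  set K₂ : ℝ := δ * (smoothTransitionC2Bound * Cr + CΔ) * (Z * (radialConst₂ * 2)) + Kb * (radialConst₂ * 4) with hK₂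
  set K₃ : ℝ := Z * (radialConst₂ * (2 * Λ - 4 * smoothTransitionC2Bound * δ)) with hK₃
  have hA1 : (∫ s in Ioc 0 N, ∫ y, (F s y - Λ) * (psiCut N y * deriv (zetaCut N) s)) ≤
      ∫ s in Ioc 0 N, |deriv (zetaCut N) s| * K₁ := by
    refine integral_mono_ae hi1 ?_ ?_
    · exact ((continuous_deriv_zetaCut N).abs.mul continuous_const).integrableOn_Ioc
    · refine (ae_restrict_iff' measurableSet_Ioc).2 (Eventually.of_forall fun s hs => ?_)
      rw [hK₁]
      exact (le_abs_self _).trans (estimate_I (T := N) (hFb s (hτ' s hs)) hδ (hpl s (hτ' s hs)) hN0)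
  have hA23 : (∫ s in Ioc 0 N, ((∫ y, (F s y - Λ) *
        (fderiv ℝ (phiCut N N s) y (V s y) + (Δ (phiCut N N s)) y)) +
        ∫ y, 2 / cylRadius y * (F s y * fderiv ℝ (phiCut N N s) y (eR y)))) ≤
      ∫ s in Ioc 0 N, (K₂ - K₃) * zetaCut N s := by
    refine integral_mono_ae (hi2.fun_add hi3) ?_ ?_
    · exact (continuous_const.mul (continuous_zetaCut N)).integrableOn_Ioc
    · refine (ae_restrict_iff' measurableSet_Ioc).2 (Eventually.of_forall fun s hs => ?_)
      have hsτ := hτ' s hs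
      have e2 := estimate_II (L := N) (T := N) (hFb s hsτ) (hVb s hsτ) (hVr s hsτ)
        hδ (hpl s hsτ) hCΔ hN1
      have e3 := estimate_III (L := N) (T := N) (hF s hsτ) hδ (hpl s hsτ) hN1
      have e2' := le_abs_self (∫ y, (F s y - Λ) *
        (fderiv ℝ (phiCut N N s) y (V s y) + (Δ (phiCut N N s)) y))
      rw [hK₂, hK₃]
      rw [← hZ, ← hKb] at e2
      rw [← hZ] at e3
      nlinarith [e2, e3, e2', (zetaCut_mem_Icc N s).1]
  have hIζ' := integral_abs_deriv_zetaCut_le N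
  have hIζ := sub_three_le_integral_zetaCut hN3
  have hIζle := integral_zetaCut_le hN0
  have hR1 : (∫ s in Ioc 0 N, |deriv (zetaCut N) s| * K₁) = (∫ s in Ioc 0 N, |deriv (zetaCut N) s|) * K₁ :=
    integral_mul_const K₁ _
  have hR2 : (∫ s in Ioc 0 N, (K₂ - K₃) * zetaCut N s) = (K₂ - K₃) * ∫ s in Ioc 0 N, zetaCut N s :=
    integral_const_mul _ _
  -- `0 = ∫A₁ + ∫(A₂ + A₃) ≤ 4C_S K₁ + (K₂ − K₃) ∫ζ`
  have h0 : 0 ≤ 4 * smoothTransitionC2Bound * K₁ + (K₂ - K₃) * ∫ s in Ioc 0 N, zetaCut N s := by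
    have h1 : (∫ s in Ioc 0 N, |deriv (zetaCut N) s|) * K₁ ≤ 4 * smoothTransitionC2Bound * K₁ :=
      mul_le_mul_of_nonneg_right hIζ' hK₁0
    linarith [hsum, hA1, hA23, hR1, hR2, h1]
  -- rewrite `K₂ − K₃ = Kb c₂ 4 − Z c₂ m`
  have hsplit : K₂ - K₃ = Kb * (radialConst₂ * 4) -
      Z * (radialConst₂ * (2 * Λ - δ * (4 * smoothTransitionC2Bound + 2 * (smoothTransitionC2Bound * Cr + CΔ)))) := by
    rw [hK₂, hK₃]; ring
  rw [hsplit] at h0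
  set m : ℝ := 2 * Λ - δ * (4 * smoothTransitionC2Bound + 2 * (smoothTransitionC2Bound * Cr + CΔ)) with hmdef
  have hζint0 : 0 ≤ ∫ s in Ioc 0 N, zetaCut N s := by linarith
  -- `Z c₂ m ∫ζ ≤ 4 C_S K₁ + Kb c₂ 4 ∫ζ ≤ 4 C_S K₁ + Kb c₂ 4 N`
  have h1 : Z * (radialConst₂ * m) * (∫ s in Ioc 0 N, zetaCut N s) ≤
      4 * smoothTransitionC2Bound * K₁ + Kb * (radialConst₂ * 4) * N := by
    have : Kb * (radialConst₂ * 4) * (∫ s in Ioc 0 N, zetaCut N s) ≤ Kb * (radialConst₂ * 4) * N :=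
      mul_le_mul_of_nonneg_left hIζle (by positivity)
    nlinarith [h0, this]
  -- lower bound of the left-hand side
  have h2 : 2 * (N - 1) * (N - 3) * (radialConst₂ * m) ≤ Z * (radialConst₂ * m) * (∫ s in Ioc 0 N, zetaCut N s) := by
    have hcm : 0 ≤ radialConst₂ * m := mul_nonneg hc₂.le hm
    have a1 : 2 * (N - 1) * (radialConst₂ * m) ≤ Z * (radialConst₂ * m) := mul_le_mul_of_nonneg_right hηge hcm
    have a2 : 0 ≤ Z * (radialConst₂ * m) := mul_nonneg hZ0 hcm
    calc 2 * (N - 1) * (N - 3) * (radialConst₂ * m) = (2 * (N - 1) * (radialConst₂ * m)) * (N - 3) := by ring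
      _ ≤ (Z * (radialConst₂ * m)) * (N - 3) := mul_le_mul_of_nonneg_right a1 (by linarith)
      _ ≤ (Z * (radialConst₂ * m)) * (∫ s in Ioc 0 N, zetaCut N s) := mul_le_mul_of_nonneg_left hIζ a2
  have h3 : 4 * smoothTransitionC2Bound * K₁ + Kb * (radialConst₂ * 4) * N =
      N * (radialConst₂ * (4 * smoothTransitionC2Bound * ((Cf + |Λ|) + 4 * δ) + 4 * Kb)) := by
    rw [hK₁]; ring
  rw [hKb] at h3
  linarith [h1, h2, h3]

/-- **No ancient bounded-drift swirl pair has a plateau at a non-zero level** (the analytic core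
of Lei–Ren–Zhang 2019, Theorem 1.2, in the linear form of KNSS 2009, proof of Theorem 5.3):
let `(F, V)` solve the swirl equation (5.10) off the axis on `(−∞, τ) × ℝ³`, `F` smooth,
axisymmetric, bounded, vanishing on the axis, `V` smooth, divergence free, with `‖V‖ ≤ C_u` and
radial component `|⟪V, e_r⟫| ≤ C_r`; if `|F − Λ| ≤ δ` on `{1 ≤ r ≤ 2}` for all heights and all
times, with `Λ > 0` and `δ (2C_S + C_S C_r + C_Δ) < Λ` (`C_Δ` any bound for `|Δ(ξ∘r)|`), we reach
a contradiction: translate the pair in time so that the window `(0, N]` fits, apply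
`ineq_of_plateau`, and let `N → ∞`. [cite: LeiRenZhang2019, Thm 1.2 and §4 Step 6 (arXiv p. 12); KochNadirashviliSereginSverak2009, proof of Thm 5.3 (arXiv p. 10)] -/
theorem false_of_plateau
    (hF : ∀ t < τ, ContDiff ℝ ∞ (F t))
    (hFd : ContinuousOn (fun p : ℝ × (EuclideanSpace ℝ (Fin 3)) => fderiv ℝ (F p.1) p.2) (Iio τ ×ˢ univ))
    (hFΔ : ContinuousOn (fun p : ℝ × (EuclideanSpace ℝ (Fin 3)) => (Δ (F p.1)) p.2) (Iio τ ×ˢ univ))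
    (hFa : ∀ t < τ, IsAxisymmetricScalar (F t))
    (hF0 : ∀ t < τ, ∀ x, cylRadius x = 0 → F t x = 0)
    (hFb : ∀ t < τ, ∀ x, |F t x| ≤ Cf)
    (hVm : Measurable (uncurry V))
    (hVs : ∀ t < τ, ContDiff ℝ ∞ (V t))
    (hVdiv : ∀ t < τ, VectorCalculus.IsDivFree (V t))
    (hVb : ∀ t < τ, ∀ x, ‖V t x‖ ≤ Cu)
    (hVr : ∀ t < τ, ∀ x, |⟪V t x, eR x⟫| ≤ Cr)
    (heq : ∀ x, cylRadius x ≠ 0 → ∀ s t : ℝ, s ≤ t → t < τ →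
      F t x - F s x = ∫ r in s..t, ((Δ (F r)) x - fderiv ℝ (F r) x (V r x) -
        2 / cylRadius x * partialDeriv (eR x) (F r) x))
    {Λ δ CΔ : ℝ} (hΛ : 0 < Λ) (hδ : 0 ≤ δ)
    (hpl : ∀ s < τ, ∀ y, 1 ≤ cylRadius y → cylRadius y ≤ 2 → |F s y - Λ| ≤ δ)
    (hCΔ : ∀ y, |(Δ fun w : EuclideanSpace ℝ (Fin 3) => xiCut (cylRadius w)) y| ≤ CΔ)
    (hsmall : δ * (2 * smoothTransitionC2Bound + smoothTransitionC2Bound * Cr + CΔ) < Λ) : False := by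
  have hC := smoothTransitionC2Bound_nonneg
  have hc₂ := radialConst₂_pos
  have hCf : 0 ≤ Cf := (abs_nonneg _).trans (hFb (τ - 1) (by linarith) 0)
  have hCu : 0 ≤ Cu := (norm_nonneg _).trans (hVb (τ - 1) (by linarith) 0)
  have hCr : 0 ≤ Cr := (abs_nonneg _).trans (hVr (τ - 1) (by linarith) 0)
  have hCΔ0 : 0 ≤ CΔ := (abs_nonneg _).trans (hCΔ 0)
  set m : ℝ := 2 * Λ - δ * (4 * smoothTransitionC2Bound + 2 * (smoothTransitionC2Bound * Cr + CΔ)) with hm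
  have hm0 : 0 < m := by rw [hm]; nlinarith [hsmall]
  set R₀ : ℝ := 4 * smoothTransitionC2Bound * ((Cf + |Λ|) + 4 * δ) +
    4 * ((Cf + |Λ|) * (2 * smoothTransitionC2Bound * Cu +
      4 * smoothTransitionC2Bound * (smoothTransitionC2Bound + 1) + 12 * smoothTransitionC2Bound ^ 2)) with hR₀
  have hR₀0 : 0 ≤ R₀ := by positivity
  -- the window size
  set N : ℝ := R₀ / m + 5 with hN
  have hRm : 0 ≤ R₀ / m := div_nonneg hR₀0 hm0.le
  have hN5 : 5 ≤ N := by linarith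
  -- translate in time: the pair `s ↦ (F, V)(τ − 1 + (s − N))` lives up to `N + 1`
  obtain ⟨hF', hFd', hFΔ', hFa', hF0', hFb', hVm', hVs', hVdiv', hVb', hVr', heq'⟩ :=
    rescale hF hFd hFΔ hFa hF0 hFb hVm hVs hVdiv hVb hVr heq one_pos (τ - 1) 0 N
  have hτ' : N + (τ - (τ - 1)) / (1 : ℝ) ^ 2 = N + 1 := by ring
  rw [hτ'] at hF' hFd' hFΔ' hFa' hF0' hFb' hVs' hVdiv' hVb' hVr' heq'
  simp only [one_mul] at hVb' hVr'
  -- the plateau transfers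
  have hpl' : ∀ s < N + 1, ∀ y, 1 ≤ cylRadius y → cylRadius y ≤ 2 →
      |stPull ((1 : ℝ) ^ 2) 1 (τ - 1 - (1 : ℝ) ^ 2 * N) ((0 : ℝ) • eZ) F s y - Λ| ≤ δ := by
    intro s hs y h1 h2
    rw [stPull_rescale_apply]
    simp only [one_pow, one_mul, zero_smul, zero_add, one_smul]
    exact hpl _ (by linarith) y h1 h2
  have key := ineq_of_plateau (N := N) hF' hFd' hFΔ' hFa' hF0' hFb' hVm' hVs' hVdiv' hVb' hVr' heq' hδ hpl'
    hCΔ hm0.le (by linarith) (by linarith)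
  rw [← hm, ← hR₀] at key
  -- `2(N−1)(N−3) c₂ m ≤ N c₂ R₀` is impossible for `N = R₀/m + 5`
  have h1 : N * (N - 4) ≤ (N - 1) * (N - 3) := by nlinarith
  have h2 : 2 * (N - 1) * (N - 3) * (radialConst₂ * m) ≤ N * (radialConst₂ * R₀) := key
  have h3 : 2 * (N * (N - 4)) * (radialConst₂ * m) ≤ N * (radialConst₂ * R₀) := by
    have := mul_le_mul_of_nonneg_right h1 (show 0 ≤ 2 * (radialConst₂ * m) by positivity)
    nlinarith [this, h2]
  have hN0 : 0 < N := by linarith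
  have h4 : 2 * (N - 4) * m ≤ R₀ := by
    have h3' : N * (2 * (N - 4) * (radialConst₂ * m)) ≤ N * (radialConst₂ * R₀) := by nlinarith [h3]
    have h5 := le_of_mul_le_mul_left h3' hN0
    have h6 : radialConst₂ * (2 * (N - 4) * m) ≤ radialConst₂ * R₀ := by nlinarith [h5]
    exact le_of_mul_le_mul_left h6 hc₂
  have h7 : (N - 4) * m = R₀ + m := by
    rw [hN]; field_simp; ring
  nlinarith [h4, h7, hm0, hR₀0]

end Main

end LRZPair

end Literature.Analysis.FluidPDE

end
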